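import Summits.Parity.BatemanHorn.Theorems.SoloBlindAlignmentMarkov

/-!
# Khintchine's first-moment bound over sign patterns, and one pattern good for both parts
(solo-blind programme, session 10)

The abstract probabilistic step of Theorem 10.1′(e) of the solo-blind paper (previously by hand,
referee-note 23(b)).  Sign patterns are indexed, as in `SoloBlindAlignmentGeneral`, by the subsets
`U ⊆ M` of a finite set `M` of cofactors: `sgn_U(m) = −1` for `m ∈ U` and `+1` otherwise, so the uniform
measure on `{±1}^M` is the counting measure on `M.powerset` divided by `2^{#M}`.

* `sum_powerset_sq_eq`, `sum_powerset_sq_eq_of_subset` — exact second moment (orthogonality of the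
  Rademacher system), for `C ⊆ M` and real weights `b`:
  `∑_{U ⊆ M} (∑_{m ∈ C} sgn_U(m) b_m)² = 2^{#M} ∑_{m ∈ C} b_m²`;
* `sum_powerset_abs_le` — Khintchine's inequality for the first moment with constant `1`
  (Cauchy–Schwarz): `∑_{U ⊆ M} |∑_{m ∈ C} sgn_U(m) b_m| ≤ 2^{#M} (∑_{m ∈ C} b_m²)^{1/2}`;
* `sum_powerset_fibrewise_abs_le` — the same summed over a finite family of fibres `n` with cofactor
  sets `I_n ⊆ M` and weights `b_{m,n}`:
  `∑_{U ⊆ M} ∑_n |∑_{m ∈ I_n} sgn_U(m) b_{m,n}| ≤ 2^{#M} ∑_n (∑_{m ∈ I_n} b_{m,n}²)^{1/2}`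
  — the bound "`E_ξ Y(ξ) ≤ ∑_n (∑_m b_{mn}²)^{1/2}`" of Theorem 10.1′(e);
* `exists_good_and_le` — Markov + pigeonhole: if at least `#P/(2D)` members of a finite set `P` are
  good and a nonnegative `Y` has `∑_P Y ≤ #P · Ȳ`, then some good member has `Y ≤ 4D · Ȳ`;
* `exists_pattern_aligned_and_small` — the combination used in Theorem 10.1′(e): under the
  hypotheses of `card_good_patterns` (values `v` injective on `[0, x]`, moduli `n ∣ v(k)` with fibres
  of size `≤ D`, cofactors in `M`, at least one edge) and for any finite fibre family with cofactor
  sets `I_n ⊆ M` and real weights `b`, ONE sign pattern `ξ = sgn_U` has simultaneously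
  `E ≤ 2D · B(ξ, κ(ξ))` (the `a`-part keeps the fraction `1/(2D)` of the trivial bound `E`) and
  `∑_n |∑_{m ∈ I_n} ξ_m b_{m,n}| ≤ 4D · ∑_n (∑_m b_{m,n}²)^{1/2}` (the `b`-part has square-root
  cancellation in every fibre).

Mathlib only (through the imported framework files); no `sorry`.
-/

open Finset

namespace Summit.Parity.BatemanHorn.Theorems.SoloBlindKhintchine

open Summit.Parity.BatemanHorn.Theorems.SoloBlindAlignmentGeneral
open Summit.Parity.BatemanHorn.Theorems.SoloBlindAlignmentMarkov

/-! ### The sign of a pattern as a real number -/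

/-- `sgn_U(m) = −1` (as a real number) for `m ∈ U`. -/
theorem sgn_cast_of_mem {U : Finset ℕ} {m : ℕ} (h : m ∈ U) : ((sgn U m : ℤ) : ℝ) = -1 := by
  unfold sgn; rw [if_pos h]; norm_num

/-- `sgn_U(m) = 1` (as a real number) for `m ∉ U`. -/
theorem sgn_cast_of_not_mem {U : Finset ℕ} {m : ℕ} (h : m ∉ U) : ((sgn U m : ℤ) : ℝ) = 1 := by
  unfold sgn; rw [if_neg h]; norm_num

/-- For `m ∈ M` and `a ∉ M`, inserting `a` into the pattern does not change the sign at `m`; hence the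
weighted sum over `M` is unchanged. -/
theorem sum_sgn_insert_eq {M : Finset ℕ} {a : ℕ} (ha : a ∉ M) (U : Finset ℕ) (b : ℕ → ℝ) :
    ∑ m ∈ M, ((sgn (insert a U) m : ℤ) : ℝ) * b m = ∑ m ∈ M, ((sgn U m : ℤ) : ℝ) * b m := by
  refine Finset.sum_congr rfl fun m hm => ?_
  have hma : m ≠ a := fun h => ha (h ▸ hm)
  by_cases h : m ∈ U
  · rw [sgn_cast_of_mem h, sgn_cast_of_mem (Finset.mem_insert_of_mem h)]
  · have h' : m ∉ insert a U := fun h'' => by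
      rcases Finset.mem_insert.mp h'' with h1 | h1
      · exact hma h1
      · exact h h1
    rw [sgn_cast_of_not_mem h, sgn_cast_of_not_mem h']

/-! ### Exact second moment (orthogonality of the Rademacher system) -/

/-- **Second moment.** `∑_{U ⊆ M} (∑_{m ∈ M} sgn_U(m) b_m)² = 2^{#M} · ∑_{m ∈ M} b_m²`. -/
theorem sum_powerset_sq_eq (M : Finset ℕ) (b : ℕ → ℝ) :
    ∑ U ∈ M.powerset, (∑ m ∈ M, ((sgn U m : ℤ) : ℝ) * b m) ^ 2
      = 2 ^ M.card * ∑ m ∈ M, b m ^ 2 := by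
  classical
  refine Finset.induction_on M ?_ ?_
  · simp
  · intro a M ha ih
    rw [Finset.sum_powerset_insert ha, Finset.card_insert_eq_ite, if_neg ha, Finset.sum_insert ha]
    have hT : ∀ U ∈ M.powerset,
        ∑ m ∈ insert a M, ((sgn U m : ℤ) : ℝ) * b m = b a + ∑ m ∈ M, ((sgn U m : ℤ) : ℝ) * b m := by
      intro U hU
      have haU : a ∉ U := fun h => ha (Finset.mem_powerset.mp hU h)
      rw [Finset.sum_insert ha, sgn_cast_of_not_mem haU, one_mul]
    have hT' : ∀ U ∈ M.powerset,
        ∑ m ∈ insert a M, ((sgn (insert a U) m : ℤ) : ℝ) * b m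
          = -b a + ∑ m ∈ M, ((sgn U m : ℤ) : ℝ) * b m := by
      intro U _
      rw [Finset.sum_insert ha, sgn_cast_of_mem (Finset.mem_insert_self a U), sum_sgn_insert_eq ha]
      ring
    have key : ∑ U ∈ M.powerset, ((∑ m ∈ insert a M, ((sgn U m : ℤ) : ℝ) * b m) ^ 2
        + (∑ m ∈ insert a M, ((sgn (insert a U) m : ℤ) : ℝ) * b m) ^ 2)
        = ∑ U ∈ M.powerset, (2 * b a ^ 2 + 2 * (∑ m ∈ M, ((sgn U m : ℤ) : ℝ) * b m) ^ 2) := by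
      refine Finset.sum_congr rfl fun U hU => ?_
      rw [hT U hU, hT' U hU]; ring
    rw [← Finset.sum_add_distrib, key, Finset.sum_add_distrib, Finset.sum_const, Finset.card_powerset,
      ← Finset.mul_sum, ih, nsmul_eq_mul]
    push_cast
    ring

/-- **Second moment for a sub-family `C ⊆ M` of cofactors.**
`∑_{U ⊆ M} (∑_{m ∈ C} sgn_U(m) b_m)² = 2^{#M} · ∑_{m ∈ C} b_m²`. -/
theorem sum_powerset_sq_eq_of_subset {M C : Finset ℕ} (hCM : C ⊆ M) (b : ℕ → ℝ) :
    ∑ U ∈ M.powerset, (∑ m ∈ C, ((sgn U m : ℤ) : ℝ) * b m) ^ 2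
      = 2 ^ M.card * ∑ m ∈ C, b m ^ 2 := by
  classical
  have h := sum_powerset_sq_eq M (fun m => if m ∈ C then b m else 0)
  have h1 : ∀ U : Finset ℕ, ∑ m ∈ M, ((sgn U m : ℤ) : ℝ) * (if m ∈ C then b m else 0)
      = ∑ m ∈ C, ((sgn U m : ℤ) : ℝ) * b m := by
    intro U
    rw [← Finset.sum_subset hCM (f := fun m => ((sgn U m : ℤ) : ℝ) * (if m ∈ C then b m else 0)) ?_]
    · exact Finset.sum_congr rfl fun m hm => by rw [if_pos hm]
    · intro m _ hmC
      rw [if_neg hmC, mul_zero]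
  have h2 : ∑ m ∈ M, (if m ∈ C then b m else 0) ^ 2 = ∑ m ∈ C, b m ^ 2 := by
    rw [← Finset.sum_subset hCM (f := fun m => (if m ∈ C then b m else 0) ^ 2) ?_]
    · exact Finset.sum_congr rfl fun m hm => by rw [if_pos hm]
    · intro m _ hmC
      rw [if_neg hmC]; ring
  simp_rw [h1] at h
  rw [h2] at h
  exact h

/-! ### Khintchine's inequality, first moment -/

/-- **Khintchine, first moment, constant `1`.** For `C ⊆ M`:
`∑_{U ⊆ M} |∑_{m ∈ C} sgn_U(m) b_m| ≤ 2^{#M} · (∑_{m ∈ C} b_m²)^{1/2}`, i.e. `E_ξ |∑ ξ_m b_m| ≤ ‖b‖₂`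
for `ξ` uniform on `{±1}^M`. -/
theorem sum_powerset_abs_le {M C : Finset ℕ} (hCM : C ⊆ M) (b : ℕ → ℝ) :
    ∑ U ∈ M.powerset, |∑ m ∈ C, ((sgn U m : ℤ) : ℝ) * b m|
      ≤ 2 ^ M.card * Real.sqrt (∑ m ∈ C, b m ^ 2) := by
  have hcs : (∑ U ∈ M.powerset, (1 : ℝ) * |∑ m ∈ C, ((sgn U m : ℤ) : ℝ) * b m|) ^ 2
      ≤ (∑ U ∈ M.powerset, (1 : ℝ) ^ 2) * ∑ U ∈ M.powerset, |∑ m ∈ C, ((sgn U m : ℤ) : ℝ) * b m| ^ 2 :=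
    Finset.sum_mul_sq_le_sq_mul_sq _ _ _
  have h1 : ∑ U ∈ M.powerset, (1 : ℝ) * |∑ m ∈ C, ((sgn U m : ℤ) : ℝ) * b m|
      = ∑ U ∈ M.powerset, |∑ m ∈ C, ((sgn U m : ℤ) : ℝ) * b m| :=
    Finset.sum_congr rfl fun _ _ => one_mul _
  have h2 : ∑ U ∈ M.powerset, (1 : ℝ) ^ 2 = 2 ^ M.card := by
    simp [Finset.card_powerset]
  have h3 : ∑ U ∈ M.powerset, |∑ m ∈ C, ((sgn U m : ℤ) : ℝ) * b m| ^ 2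
      = 2 ^ M.card * ∑ m ∈ C, b m ^ 2 := by
    simp_rw [sq_abs]
    exact sum_powerset_sq_eq_of_subset hCM b
  rw [h1, h2, h3] at hcs
  have hnn : 0 ≤ ∑ U ∈ M.powerset, |∑ m ∈ C, ((sgn U m : ℤ) : ℝ) * b m| :=
    Finset.sum_nonneg fun U _ => abs_nonneg _
  have hb : 0 ≤ ∑ m ∈ C, b m ^ 2 := Finset.sum_nonneg fun m _ => sq_nonneg (b m)
  have hy : 0 ≤ (2 : ℝ) ^ M.card * Real.sqrt (∑ m ∈ C, b m ^ 2) := by positivity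
  have hsq : (∑ U ∈ M.powerset, |∑ m ∈ C, ((sgn U m : ℤ) : ℝ) * b m|) ^ 2
      ≤ ((2 : ℝ) ^ M.card * Real.sqrt (∑ m ∈ C, b m ^ 2)) ^ 2 := by
    rw [mul_pow, Real.sq_sqrt hb]
    calc (∑ U ∈ M.powerset, |∑ m ∈ C, ((sgn U m : ℤ) : ℝ) * b m|) ^ 2
        ≤ (2 : ℝ) ^ M.card * (2 ^ M.card * ∑ m ∈ C, b m ^ 2) := hcs
      _ = ((2 : ℝ) ^ M.card) ^ 2 * ∑ m ∈ C, b m ^ 2 := by ring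
  have h := Real.sqrt_le_sqrt hsq
  rwa [Real.sqrt_sq hnn, Real.sqrt_sq hy] at h

/-- **First moment, fibre by fibre** — the bound `E_ξ Y(ξ) ≤ ∑_n (∑_m b_{m,n}²)^{1/2}` of
Theorem 10.1′(e): for fibres `n ∈ Ns` with cofactor sets `I_n ⊆ M` and real weights `b_{m,n}`,
`∑_{U ⊆ M} ∑_{n ∈ Ns} |∑_{m ∈ I_n} sgn_U(m) b_{m,n}| ≤ 2^{#M} · ∑_{n ∈ Ns} (∑_{m ∈ I_n} b_{m,n}²)^{1/2}`. -/
theorem sum_powerset_fibrewise_abs_le {M : Finset ℕ} (Ns : Finset ℕ) {I : ℕ → Finset ℕ}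
    (hI : ∀ n ∈ Ns, I n ⊆ M) (b : ℕ → ℕ → ℝ) :
    ∑ U ∈ M.powerset, ∑ n ∈ Ns, |∑ m ∈ I n, ((sgn U m : ℤ) : ℝ) * b m n|
      ≤ 2 ^ M.card * ∑ n ∈ Ns, Real.sqrt (∑ m ∈ I n, b m n ^ 2) := by
  rw [Finset.sum_comm, Finset.mul_sum]
  exact Finset.sum_le_sum fun n hn => sum_powerset_abs_le (hI n hn) (fun m => b m n)

/-! ### One pattern good for both parts -/

/-- **Markov and pigeonhole.** If at least `#P/(2D)` members of a nonempty finite set `P` are `good`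
and a nonnegative `Y` has `∑_{U ∈ P} Y(U) ≤ #P · Ȳ`, then some `good` member has `Y ≤ 4D · Ȳ`. -/
theorem exists_good_and_le {ι : Type*} (P : Finset ι) (good : ι → Prop) [DecidablePred good]
    (Y : ι → ℝ) (D : ℕ) (Ybar : ℝ) (hP : P.Nonempty)
    (hgood : (P.card : ℤ) ≤ 2 * (D : ℤ) * ((P.filter good).card : ℤ))
    (hY0 : ∀ U ∈ P, 0 ≤ Y U) (hsum : ∑ U ∈ P, Y U ≤ (P.card : ℝ) * Ybar) :
    ∃ U ∈ P, good U ∧ Y U ≤ 4 * (D : ℝ) * Ybar := by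
  by_contra hcon
  have hcon' : ∀ U ∈ P, good U → 4 * (D : ℝ) * Ybar < Y U := by
    intro U hU hg
    by_contra hle
    exact hcon ⟨U, hU, hg, not_lt.mp hle⟩
  have hgood' : (P.card : ℝ) ≤ 2 * (D : ℝ) * ((P.filter good).card : ℝ) := by exact_mod_cast hgood
  have hPpos : (0 : ℝ) < P.card := by exact_mod_cast hP.card_pos
  have hGpos : 0 < (P.filter good).card := by
    rcases Nat.eq_zero_or_pos (P.filter good).card with h | h
    · exfalso
      rw [h, Nat.cast_zero, mul_zero] at hgood'
      linarith
    · exact h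
  have hGne : (P.filter good).Nonempty := Finset.card_pos.mp hGpos
  have hYbar : 0 ≤ Ybar := by
    by_contra h
    have h' : Ybar < 0 := not_le.mp h
    have h1 : (P.card : ℝ) * Ybar < 0 := mul_neg_of_pos_of_neg hPpos h'
    have h2 : 0 ≤ ∑ U ∈ P, Y U := Finset.sum_nonneg hY0
    linarith
  have hlt : ∑ U ∈ P.filter good, 4 * (D : ℝ) * Ybar < ∑ U ∈ P.filter good, Y U :=
    Finset.sum_lt_sum_of_nonempty hGne fun U hU =>
      hcon' U (Finset.mem_filter.mp hU).1 (Finset.mem_filter.mp hU).2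
  rw [Finset.sum_const, nsmul_eq_mul] at hlt
  have hle : ∑ U ∈ P.filter good, Y U ≤ ∑ U ∈ P, Y U :=
    Finset.sum_le_sum_of_subset_of_nonneg (Finset.filter_subset _ _) fun U hU _ => hY0 U hU
  have h4 : (P.card : ℝ) * Ybar ≤ 2 * (D : ℝ) * ((P.filter good).card : ℝ) * Ybar :=
    mul_le_mul_of_nonneg_right hgood' hYbar
  have hprod : 0 ≤ (D : ℝ) * ((P.filter good).card : ℝ) * Ybar := by positivity
  linarith

/-- **One pattern good for both parts** (Theorem 10.1′(e) of the solo-blind paper).  Under the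
hypotheses of `card_good_patterns` — `v` injective on `[0, x]`, moduli `n ∈ N(k)` dividing `v(k)`,
all cofactors `v(k)/n` in `M`, fibres of size `≤ D`, at least one edge — and for any finite family of
fibres `Ns` with cofactor sets `I_n ⊆ M` and real weights `b_{m,n}`, there is a sign pattern
`ξ = sgn_U`, `U ⊆ M`, with BOTH `E ≤ 2D · B(ξ, κ(ξ))` (aligned bilinear form at least the fraction
`1/(2D)` of the trivial bound) AND
`∑_{n ∈ Ns} |∑_{m ∈ I_n} ξ_m b_{m,n}| ≤ 4D · ∑_{n ∈ Ns} (∑_{m ∈ I_n} b_{m,n}²)^{1/2}`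
(square-root cancellation of the comparison term in every fibre). -/
theorem exists_pattern_aligned_and_small (x D : ℕ) {v : ℕ → ℕ} {N : ℕ → Finset ℕ} {M : Finset ℕ}
    (hv : Set.InjOn v ↑(range (x + 1))) (hdvd : ∀ k ∈ range (x + 1), ∀ n ∈ N k, n ∣ v k)
    (hM : ∀ k ∈ range (x + 1), ∀ n ∈ N k, v k / n ∈ M)
    (hD : ∀ n ∈ moduli x N, (fibre x N n).card ≤ D) (hE : 0 < edgeCount x N)
    (Ns : Finset ℕ) {I : ℕ → Finset ℕ} (hI : ∀ n ∈ Ns, I n ⊆ M) (b : ℕ → ℕ → ℝ) :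
    ∃ U ∈ M.powerset,
      (edgeCount x N : ℤ) ≤ 2 * (D : ℤ) * bilin x v N (sgn U) (aligned x v N (sgn U)) ∧
      ∑ n ∈ Ns, |∑ m ∈ I n, ((sgn U m : ℤ) : ℝ) * b m n|
        ≤ 4 * (D : ℝ) * ∑ n ∈ Ns, Real.sqrt (∑ m ∈ I n, b m n ^ 2) := by
  classical
  have hgood := card_good_patterns x D hv hdvd hM hD hE
  have hP : ((M.powerset).card : ℤ) = (2 : ℤ) ^ M.card := by simp [Finset.card_powerset]
  have hP' : ((M.powerset).card : ℝ) = (2 : ℝ) ^ M.card := by simp [Finset.card_powerset]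
  refine exists_good_and_le M.powerset
    (fun U => (edgeCount x N : ℤ) ≤ 2 * (D : ℤ) * bilin x v N (sgn U) (aligned x v N (sgn U)))
    (fun U => ∑ n ∈ Ns, |∑ m ∈ I n, ((sgn U m : ℤ) : ℝ) * b m n|) D
    (∑ n ∈ Ns, Real.sqrt (∑ m ∈ I n, b m n ^ 2)) ⟨∅, Finset.empty_mem_powerset M⟩ ?_ ?_ ?_
  · rw [hP]
    convert hgood
  · intro U _
    exact Finset.sum_nonneg fun n _ => abs_nonneg _
  · rw [hP']
    exact sum_powerset_fibrewise_abs_le Ns hI b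

end Summit.Parity.BatemanHorn.Theorems.SoloBlindKhintchine
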